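import Mathlib

/-!
# `CMTwistQuasiPeriodTransfer` (stmt-KontsevichZagierPeriods-3416, route HermiteRigidity):
# the real `2`-isogeny `ψ` of `y² = 4x³ − 120x + 224` — algebra and analysis

Helper file (lands `--supports stmt-KontsevichZagierPeriods-3416`). The curve
`y² = f(x) = 4x³ − 120x + 224 = 4(x − 4)(x − e₂)(x − e₃)`, `e₃ = −2 − 3√2 < e₂ = −2 + 3√2 < e₁ = 4`,
has `j = 8000` and complex multiplication by `ℤ[√−2]`. In the ORIGINAL coordinate `x` the
`x`-coordinate of the endomorphism `[√−2]` (Silverman's `−(X + 4 + 2/X)/2` on the model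
`Y² = X³ + 4X² + 2X`, `x = 3X + 4`) is the real rational map
`ψ(x) = −x/2 − 9/(x − 4)`, `ψ′(x) = −1/2 + 9/(x − 4)²`,
and `[√−2]^* (dx/y) = √−2 · dx/y` reads `f(ψ(x)) = −f(x)·ψ′(x)²/2` (`f_psi`; the `y`-coordinate
is `y·ψ′(x)/√−2`). Consequently `ψ` maps the bounded oval `(e₃, e₂)` (where `f > 0`) onto `(e₂, 4)` (where
`f < 0`), folding it `2 : 1` at the critical point `m = 4 − 3√2` (`ψ(e₃) = ψ(e₂) = 4`, `ψ(m) = e₂`):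
each half `(e₃, m)`, `(m, e₂)` is mapped bijectively onto `(e₂, 4)` (`psi_injOn_left/right`,
`psi_image_left/right`). Everything here is elementary real algebra/analysis with the constant
`√2`; the moves of the Kontsevich–Zagier calculus are applied in the sibling files. All expressions
are written out explicitly (no definitions are introduced).

References: J. H. Silverman, *Advanced Topics in the Arithmetic of Elliptic Curves* (1994),
Prop. II.2.3.1 (the curve `y² = x³ + 4x² + 2x`, which is `y² = f(3X + 4)/108`);
D. Masser, *Elliptic Functions and Transcendence* (1975), Lemma 3.1.
-/

noncomputable section

open Set

namespace Summit.KontsevichZagierPeriods.HermiteRigidity.CMTwistQuasiPeriodTransfer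

/-! ### The cubic `f(x) = 4x³ − 120x + 224`

The constant `√2` enters through `(√2)² = 2` and `0 < √2`, used throughout as
`Real.sq_sqrt zero_le_two` and `Real.sqrt_pos.mpr zero_lt_two`. -/

/-- `f = 4(x − 4)(x − e₂)(x − e₃)` with `e₂ = −2 + 3√2`, `e₃ = −2 − 3√2`. [folklore] -/
theorem f_factor (x : ℝ) : 4 * x ^ 3 - 120 * x + 224 =
    4 * (x - 4) * ((x - (-2 + 3 * Real.sqrt 2)) * (x - (-2 - 3 * Real.sqrt 2))) := by
  linear_combination (36 * (x - 4)) * (Real.sq_sqrt zero_le_two : Real.sqrt 2 ^ 2 = 2)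

/-- The roots are ordered: `e₃ < e₂ < 4`, and `e₃ < m = 4 − 3√2 < e₂`, `0 < e₂`. [folklore] -/
theorem roots_order : (-2 - 3 * Real.sqrt 2) < 4 - 3 * Real.sqrt 2 ∧
    4 - 3 * Real.sqrt 2 < -2 + 3 * Real.sqrt 2 ∧ -2 + 3 * Real.sqrt 2 < 4 ∧
    (0 : ℝ) < -2 + 3 * Real.sqrt 2 := by
  have h : Real.sqrt 2 ^ 2 = 2 := Real.sq_sqrt zero_le_two
  have h0 : 0 < Real.sqrt 2 := Real.sqrt_pos.mpr zero_lt_two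
  have h1 : (1.41 : ℝ) < Real.sqrt 2 := by nlinarith
  have h2 : Real.sqrt 2 < (1.42 : ℝ) := by nlinarith
  refine ⟨by linarith, by linarith, by linarith, by linarith⟩

/-- For `x < 4`: `f(x) > 0 ↔ e₃ < x < e₂`. [folklore] -/
theorem f_pos_iff {x : ℝ} (hx : x < 4) : 0 < 4 * x ^ 3 - 120 * x + 224 ↔
    (-2 - 3 * Real.sqrt 2) < x ∧ x < -2 + 3 * Real.sqrt 2 := by
  obtain ⟨h1, h2, h3, h4⟩ := roots_order
  have key : 4 * x ^ 3 - 120 * x + 224 =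
      (4 * (4 - x)) * ((-2 + 3 * Real.sqrt 2 - x) * (x - (-2 - 3 * Real.sqrt 2))) := by
    rw [f_factor]; ring
  have h4x : 0 < 4 * (4 - x) := by linarith
  rw [key, mul_pos_iff_of_pos_left h4x]
  constructor
  · intro h
    rcases pos_and_pos_or_neg_and_neg_of_mul_pos h with ⟨ha, hb⟩ | ⟨ha, hb⟩
    · exact ⟨by linarith, by linarith⟩
    · exfalso; linarith
  · rintro ⟨ha, hb⟩
    exact mul_pos (by linarith) (by linarith)

/-- For `0 < x`: `f(x) < 0 ↔ e₂ < x < 4`. [folklore] -/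
theorem f_neg_iff {x : ℝ} (hx : 0 < x) : 4 * x ^ 3 - 120 * x + 224 < 0 ↔
    -2 + 3 * Real.sqrt 2 < x ∧ x < 4 := by
  obtain ⟨h1, h2, h3, h4⟩ := roots_order
  have hs := (Real.sqrt_pos.mpr zero_lt_two : 0 < Real.sqrt 2)
  have key : 4 * x ^ 3 - 120 * x + 224 =
      (4 * (x - (-2 - 3 * Real.sqrt 2))) * ((x - 4) * (x - (-2 + 3 * Real.sqrt 2))) := by
    rw [f_factor]; ring
  have hc : 0 < 4 * (x - (-2 - 3 * Real.sqrt 2)) := by linarith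
  rw [key]
  constructor
  · intro h
    have hprod : (x - 4) * (x - (-2 + 3 * Real.sqrt 2)) < 0 := by
      by_contra hcon
      have := mul_nonneg hc.le (not_lt.mp hcon)
      linarith
    rcases mul_neg_iff.mp hprod with ⟨ha, hb⟩ | ⟨ha, hb⟩
    · exfalso; linarith
    · exact ⟨by linarith, by linarith⟩
  · rintro ⟨ha, hb⟩
    exact mul_neg_of_pos_of_neg hc (mul_neg_of_neg_of_pos (by linarith) (by linarith))

/-- `f > 0` on `(e₃, e₂)`. [folklore] -/
theorem f_pos_of_mem {x : ℝ} (hx : x ∈ Ioo (-2 - 3 * Real.sqrt 2) (-2 + 3 * Real.sqrt 2)) :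
    0 < 4 * x ^ 3 - 120 * x + 224 :=
  (f_pos_iff (hx.2.trans roots_order.2.2.1)).mpr hx

/-- `f(e₃) = 0`. [folklore] -/
theorem f_e3 : 4 * (-2 - 3 * Real.sqrt 2) ^ 3 - 120 * (-2 - 3 * Real.sqrt 2) + 224 = 0 := by
  rw [f_factor]; ring

/-- `f(e₂) = 0`. [folklore] -/
theorem f_e2 : 4 * (-2 + 3 * Real.sqrt 2) ^ 3 - 120 * (-2 + 3 * Real.sqrt 2) + 224 = 0 := by
  rw [f_factor]; ring

/-! ### The isogeny `ψ(x) = −x/2 − 9/(x − 4)` -/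

/-- `ψ′`: `ψ` has derivative `−1/2 + 9/(x − 4)²` at every `x ≠ 4`. [folklore] -/
theorem hasDerivAt_psi {x : ℝ} (hx : x ≠ 4) :
    HasDerivAt (fun y : ℝ => -y / 2 - 9 / (y - 4)) (-1 / 2 + 9 / (x - 4) ^ 2) x := by
  have hx' : x - 4 ≠ 0 := sub_ne_zero.mpr hx
  have h1 : HasDerivAt (fun y : ℝ => -y / 2) (-1 / 2) x := by
    simpa using ((hasDerivAt_id x).neg.div_const 2)
  have h2 : HasDerivAt (fun y : ℝ => 9 / (y - 4)) (-9 / (x - 4) ^ 2) x := by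
    refine ((hasDerivAt_const x (9 : ℝ)).fun_div ((hasDerivAt_id x).sub_const 4)
      hx').congr_deriv ?_
    simp only [id_eq, zero_mul, mul_one, zero_sub]
  refine (h1.sub h2).congr_deriv ?_
  ring

/-- **Invariance of `dx/y` up to `√−2`**: `f(ψ(x)) = −f(x)·ψ′(x)²/2` for `x ≠ 4`. [folklore] -/
theorem f_psi {x : ℝ} (hx : x ≠ 4) :
    4 * (-x / 2 - 9 / (x - 4)) ^ 3 - 120 * (-x / 2 - 9 / (x - 4)) + 224 =
      -(4 * x ^ 3 - 120 * x + 224) * (-1 / 2 + 9 / (x - 4) ^ 2) ^ 2 / 2 := by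
  have hx' : x - 4 ≠ 0 := sub_ne_zero.mpr hx
  field_simp
  ring

/-- `4 − ψ(x) = (x − e₂)(x − e₃)/(2(x − 4))`. [folklore] -/
theorem four_sub_psi {x : ℝ} (hx : x ≠ 4) :
    4 - (-x / 2 - 9 / (x - 4)) = (x ^ 2 + 4 * x - 14) / (2 * (x - 4)) := by
  have hx' : x - 4 ≠ 0 := sub_ne_zero.mpr hx
  field_simp
  ring

/-- `ψ(x) − e₂ = −(x − m)²/(2(x − 4))`, `m = 4 − 3√2`. [folklore] -/
theorem psi_sub_e2 {x : ℝ} (hx : x ≠ 4) :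
    (-x / 2 - 9 / (x - 4)) - (-2 + 3 * Real.sqrt 2) =
      -(x - (4 - 3 * Real.sqrt 2)) ^ 2 / (2 * (x - 4)) := by
  have hx' : x - 4 ≠ 0 := sub_ne_zero.mpr hx
  rw [eq_div_iff (mul_ne_zero two_ne_zero hx')]
  field_simp
  linear_combination (9 : ℝ) * (Real.sq_sqrt zero_le_two : Real.sqrt 2 ^ 2 = 2)

/-- `ψ < 4` on `(e₃, e₂)`. [folklore] -/
theorem psi_lt_four {x : ℝ} (hx : x ∈ Ioo (-2 - 3 * Real.sqrt 2) (-2 + 3 * Real.sqrt 2)) :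
    -x / 2 - 9 / (x - 4) < 4 := by
  obtain ⟨-, -, h24, -⟩ := roots_order
  have hx4 : x < 4 := hx.2.trans h24
  have h := four_sub_psi hx4.ne
  have hnum : x ^ 2 + 4 * x - 14 < 0 := by
    have : x ^ 2 + 4 * x - 14 = (x - (-2 + 3 * Real.sqrt 2)) * (x - (-2 - 3 * Real.sqrt 2)) := by
      linear_combination (9 : ℝ) * (Real.sq_sqrt zero_le_two : Real.sqrt 2 ^ 2 = 2)
    rw [this]
    exact mul_neg_of_neg_of_pos (by linarith [hx.2]) (by linarith [hx.1])
  have hpos : 0 < (x ^ 2 + 4 * x - 14) / (2 * (x - 4)) :=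
    div_pos_of_neg_of_neg hnum (by linarith)
  linarith

/-- `e₂ < ψ` on `(e₃, e₂)` off the critical point `m`. [folklore] -/
theorem e2_lt_psi {x : ℝ} (hx : x ∈ Ioo (-2 - 3 * Real.sqrt 2) (-2 + 3 * Real.sqrt 2))
    (hm : x ≠ 4 - 3 * Real.sqrt 2) : -2 + 3 * Real.sqrt 2 < -x / 2 - 9 / (x - 4) := by
  obtain ⟨-, -, h24, -⟩ := roots_order
  have hx4 : x < 4 := hx.2.trans h24
  have h := psi_sub_e2 hx4.ne
  have hpos : 0 < -(x - (4 - 3 * Real.sqrt 2)) ^ 2 / (2 * (x - 4)) := by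
    apply div_pos_of_neg_of_neg
    · have : 0 < (x - (4 - 3 * Real.sqrt 2)) ^ 2 := by positivity
      linarith
    · linarith
  linarith

/-- `ψ(e₃) = 4`. [folklore] -/
theorem psi_e3 : -(-2 - 3 * Real.sqrt 2) / 2 - 9 / ((-2 - 3 * Real.sqrt 2) - 4) = 4 := by
  obtain ⟨h1, h2, h3, -⟩ := roots_order
  have h := four_sub_psi (x := -2 - 3 * Real.sqrt 2) (by linarith : (-2 - 3 * Real.sqrt 2) < 4).ne
  have hnum : (-2 - 3 * Real.sqrt 2) ^ 2 + 4 * (-2 - 3 * Real.sqrt 2) - 14 = 0 := by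
    linear_combination (9 : ℝ) * (Real.sq_sqrt zero_le_two : Real.sqrt 2 ^ 2 = 2)
  rw [hnum, zero_div] at h
  linarith

/-- `ψ(e₂) = 4`. [folklore] -/
theorem psi_e2 : -(-2 + 3 * Real.sqrt 2) / 2 - 9 / ((-2 + 3 * Real.sqrt 2) - 4) = 4 := by
  obtain ⟨h1, h2, h3, -⟩ := roots_order
  have h := four_sub_psi (x := -2 + 3 * Real.sqrt 2) h3.ne
  have hnum : (-2 + 3 * Real.sqrt 2) ^ 2 + 4 * (-2 + 3 * Real.sqrt 2) - 14 = 0 := by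
    linear_combination (9 : ℝ) * (Real.sq_sqrt zero_le_two : Real.sqrt 2 ^ 2 = 2)
  rw [hnum, zero_div] at h
  linarith

/-- `ψ(m) = e₂`. [folklore] -/
theorem psi_m : -(4 - 3 * Real.sqrt 2) / 2 - 9 / ((4 - 3 * Real.sqrt 2) - 4) =
    -2 + 3 * Real.sqrt 2 := by
  obtain ⟨h1, h2, h3, -⟩ := roots_order
  have h := psi_sub_e2 (x := 4 - 3 * Real.sqrt 2) (h2.trans h3).ne
  rw [sub_self, zero_pow two_ne_zero, neg_zero, zero_div] at h
  linarith

/-- `ψ′ < 0` to the left of `m` (for `x < m`). [folklore] -/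
theorem dpsi_neg {x : ℝ} (hx : x < 4 - 3 * Real.sqrt 2) : -1 / 2 + 9 / (x - 4) ^ 2 < 0 := by
  have hs := (Real.sqrt_pos.mpr zero_lt_two : 0 < Real.sqrt 2)
  have h4 : 3 * Real.sqrt 2 < 4 - x := by linarith
  have h18 : 18 < (x - 4) ^ 2 := by nlinarith [(Real.sq_sqrt zero_le_two : Real.sqrt 2 ^ 2 = 2)]
  have hpos : 0 < (x - 4) ^ 2 := lt_trans (by norm_num) h18
  rw [div_add_div _ _ two_ne_zero hpos.ne', div_neg_iff]
  exact Or.inr ⟨by nlinarith, mul_pos two_pos hpos⟩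

/-- `ψ′ > 0` on `(m, e₂)`. [folklore] -/
theorem dpsi_pos {x : ℝ} (hx : x ∈ Ioo (4 - 3 * Real.sqrt 2) (-2 + 3 * Real.sqrt 2)) :
    0 < -1 / 2 + 9 / (x - 4) ^ 2 := by
  have hs := (Real.sqrt_pos.mpr zero_lt_two : 0 < Real.sqrt 2)
  obtain ⟨-, -, h3, -⟩ := roots_order
  have h4 : 0 < 4 - x := by linarith [hx.2]
  have h4' : 4 - x < 3 * Real.sqrt 2 := by linarith [hx.1]
  have h18 : (x - 4) ^ 2 < 18 := by nlinarith [(Real.sq_sqrt zero_le_two : Real.sqrt 2 ^ 2 = 2)]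
  have hpos : 0 < (x - 4) ^ 2 := by nlinarith
  rw [div_add_div _ _ two_ne_zero hpos.ne']
  exact div_pos (by nlinarith) (mul_pos two_pos hpos)

/-- The fibres of `ψ`: `ψ(x) = ψ(y)` with `x, y ≠ 4` forces `x = y` or `(x − 4)(y − 4) = 18`.
[folklore] -/
theorem psi_eq_psi_iff {x y : ℝ} (hx : x ≠ 4) (hy : y ≠ 4)
    (h : -x / 2 - 9 / (x - 4) = -y / 2 - 9 / (y - 4)) : x = y ∨ (x - 4) * (y - 4) = 18 := by
  have hx' : x - 4 ≠ 0 := sub_ne_zero.mpr hx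
  have hy' : y - 4 ≠ 0 := sub_ne_zero.mpr hy
  have h2 : (y - x) * ((x - 4) * (y - 4) - 18) = 0 := by
    field_simp at h
    linear_combination h
  rcases mul_eq_zero.mp h2 with h3 | h3
  · exact Or.inl (by linarith)
  · exact Or.inr (by linarith)

/-- `ψ` is injective on the left half `(e₃, m)`. [folklore] -/
theorem psi_injOn_left :
    InjOn (fun x : ℝ => -x / 2 - 9 / (x - 4)) (Ioo (-2 - 3 * Real.sqrt 2) (4 - 3 * Real.sqrt 2)) := by
  have hs := (Real.sqrt_pos.mpr zero_lt_two : 0 < Real.sqrt 2)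
  intro x hx y hy h
  rcases psi_eq_psi_iff (by linarith [hx.2]) (by linarith [hy.2]) h with h1 | h1
  · exact h1
  · exfalso
    have h4 : 3 * Real.sqrt 2 < 4 - x := by linarith [hx.2]
    have h5 : 3 * Real.sqrt 2 < 4 - y := by linarith [hy.2]
    nlinarith [(Real.sq_sqrt zero_le_two : Real.sqrt 2 ^ 2 = 2)]

/-- `ψ` is injective on the right half `(m, e₂)`. [folklore] -/
theorem psi_injOn_right :
    InjOn (fun x : ℝ => -x / 2 - 9 / (x - 4)) (Ioo (4 - 3 * Real.sqrt 2) (-2 + 3 * Real.sqrt 2)) := by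
  have hs := (Real.sqrt_pos.mpr zero_lt_two : 0 < Real.sqrt 2)
  obtain ⟨-, -, h3, -⟩ := roots_order
  intro x hx y hy h
  rcases psi_eq_psi_iff (by linarith [hx.2]) (by linarith [hy.2]) h with h1 | h1
  · exact h1
  · exfalso
    have h4 : 0 < 4 - x := by linarith [hx.2]
    have h4' : 4 - x < 3 * Real.sqrt 2 := by linarith [hx.1]
    have h5 : 0 < 4 - y := by linarith [hy.2]
    have h5' : 4 - y < 3 * Real.sqrt 2 := by linarith [hy.1]
    have : (4 - x) * (4 - y) < 3 * Real.sqrt 2 * (3 * Real.sqrt 2) :=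
      mul_lt_mul'' h4' h5' h4.le h5.le
    nlinarith [(Real.sq_sqrt zero_le_two : Real.sqrt 2 ^ 2 = 2)]

/-- `ψ` is continuous on every set avoiding `4`. [folklore] -/
theorem continuousOn_psi {S : Set ℝ} (hS : ∀ x ∈ S, x ≠ 4) :
    ContinuousOn (fun x : ℝ => -x / 2 - 9 / (x - 4)) S := by
  refine ContinuousOn.sub (by fun_prop) (ContinuousOn.div continuousOn_const (by fun_prop) ?_)
  exact fun x hx => sub_ne_zero.mpr (hS x hx)

/-- `ψ` maps the left half `(e₃, m)` onto `(e₂, 4)`. [folklore] -/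
theorem psi_image_left : (fun x : ℝ => -x / 2 - 9 / (x - 4)) ''
    Ioo (-2 - 3 * Real.sqrt 2) (4 - 3 * Real.sqrt 2) = Ioo (-2 + 3 * Real.sqrt 2) 4 := by
  obtain ⟨h1, h2, h3, -⟩ := roots_order
  apply Subset.antisymm
  · rintro _ ⟨x, hx, rfl⟩
    have hx' : x ∈ Ioo (-2 - 3 * Real.sqrt 2) (-2 + 3 * Real.sqrt 2) := ⟨hx.1, hx.2.trans h2⟩
    exact ⟨e2_lt_psi hx' hx.2.ne, psi_lt_four hx'⟩
  · have hc : ContinuousOn (fun x : ℝ => -x / 2 - 9 / (x - 4))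
        (Icc (-2 - 3 * Real.sqrt 2) (4 - 3 * Real.sqrt 2)) :=
      continuousOn_psi fun x hx => by linarith [hx.2]
    have h := intermediate_value_Ioo' h1.le hc
    rwa [psi_e3, psi_m] at h

/-- `ψ` maps the right half `(m, e₂)` onto `(e₂, 4)`. [folklore] -/
theorem psi_image_right : (fun x : ℝ => -x / 2 - 9 / (x - 4)) ''
    Ioo (4 - 3 * Real.sqrt 2) (-2 + 3 * Real.sqrt 2) = Ioo (-2 + 3 * Real.sqrt 2) 4 := by
  obtain ⟨h1, h2, h3, -⟩ := roots_order
  apply Subset.antisymm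
  · rintro _ ⟨x, hx, rfl⟩
    have hx' : x ∈ Ioo (-2 - 3 * Real.sqrt 2) (-2 + 3 * Real.sqrt 2) := ⟨h1.trans hx.1, hx.2⟩
    exact ⟨e2_lt_psi hx' hx.1.ne', psi_lt_four hx'⟩
  · have hc : ContinuousOn (fun x : ℝ => -x / 2 - 9 / (x - 4))
        (Icc (4 - 3 * Real.sqrt 2) (-2 + 3 * Real.sqrt 2)) :=
      continuousOn_psi fun x hx => by linarith [hx.2]
    have h := intermediate_value_Ioo h2.le hc
    rwa [psi_e2, psi_m] at h

/-! ### The identities behind the moves -/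

/-- **The rule-2 weight.** On the oval (`f(x) > 0`, `x ≠ 4`, `ψ′(x) ≠ 0`):
`ψ(x)/(√2·√f(x)) = (ψ(x)/(2√(−f(ψ(x))))) · |ψ′(x)|`, i.e. the pull-back of `X dX/(2√(−f(X)))`
along `X = ψ(x)` is `ψ(x) dx/(√2 √f(x))` (from `f(ψ(x)) = −f(x)ψ′(x)²/2`). [folklore] -/
theorem weight {x : ℝ} (hx : x ≠ 4) (hf : 0 < 4 * x ^ 3 - 120 * x + 224)
    (hd : -1 / 2 + 9 / (x - 4) ^ 2 ≠ 0) :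
    (-x / 2 - 9 / (x - 4)) / (Real.sqrt 2 * Real.sqrt (4 * x ^ 3 - 120 * x + 224)) =
      (-x / 2 - 9 / (x - 4)) / Real.sqrt (-(4 * (-x / 2 - 9 / (x - 4)) ^ 3 -
        120 * (-x / 2 - 9 / (x - 4)) + 224)) / 2 * |-1 / 2 + 9 / (x - 4) ^ 2| := by
  rw [f_psi hx]
  set d : ℝ := -1 / 2 + 9 / (x - 4) ^ 2 with hd_def
  set fx : ℝ := 4 * x ^ 3 - 120 * x + 224 with hfx
  set ψ : ℝ := -x / 2 - 9 / (x - 4) with hψ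
  have h1 : -(-fx * d ^ 2 / 2) = d ^ 2 * (fx / 2) := by ring
  have hsq : Real.sqrt (-(-fx * d ^ 2 / 2)) = |d| * Real.sqrt fx / Real.sqrt 2 := by
    rw [h1, Real.sqrt_mul (sq_nonneg d), Real.sqrt_sq_eq_abs,
      Real.sqrt_div' _ (by norm_num : (0:ℝ) ≤ 2)]
    ring
  rw [hsq]
  have hS : 0 < Real.sqrt fx := Real.sqrt_pos.mpr hf
  have hc : 0 < Real.sqrt 2 := (Real.sqrt_pos.mpr zero_lt_two : 0 < Real.sqrt 2)
  have hda : 0 < |d| := abs_pos.mpr hd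
  field_simp
  rw [show Real.sqrt 2 ^ 2 = 2 from (Real.sq_sqrt zero_le_two : Real.sqrt 2 ^ 2 = 2)]

/-- **The Hermite-type primitive.** `F(x) = √f(x)/(4√2(4 − x))` has derivative
`(x² − 8x − 2)/(2(4 − x)√2√f(x))` on the oval. [folklore] -/
theorem hasDerivAt_F {x : ℝ} (hx4 : x < 4) (hf : 0 < 4 * x ^ 3 - 120 * x + 224) :
    HasDerivAt (fun y : ℝ => Real.sqrt (4 * y ^ 3 - 120 * y + 224) / (4 * Real.sqrt 2 * (4 - y)))
      ((x ^ 2 - 8 * x - 2) /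
        (2 * (4 - x) * Real.sqrt 2 * Real.sqrt (4 * x ^ 3 - 120 * x + 224))) x := by
  have hfd : HasDerivAt (fun y : ℝ => 4 * y ^ 3 - 120 * y + 224) (4 * (3 * x ^ 2) - 120) x := by
    have := (((hasDerivAt_pow 3 x).const_mul 4).sub ((hasDerivAt_id x).const_mul 120)).add_const
      224
    simpa using this
  have hsq := hfd.sqrt hf.ne'
  have hden : HasDerivAt (fun y : ℝ => 4 * Real.sqrt 2 * (4 - y)) (4 * Real.sqrt 2 * (-1)) x := by
    simpa using ((hasDerivAt_id x).const_sub 4).const_mul (4 * Real.sqrt 2)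
  have hc : 0 < Real.sqrt 2 := (Real.sqrt_pos.mpr zero_lt_two : 0 < Real.sqrt 2)
  have h4 : 0 < 4 - x := by linarith
  have hne : 4 * Real.sqrt 2 * (4 - x) ≠ 0 := by positivity
  refine (hsq.fun_div hden hne).congr_deriv ?_
  set S := Real.sqrt (4 * x ^ 3 - 120 * x + 224) with hS_def
  have hS : S ^ 2 = 4 * x ^ 3 - 120 * x + 224 := Real.sq_sqrt hf.le
  have hS0 : 0 < S := Real.sqrt_pos.mpr hf
  field_simp
  linear_combination 2 * hS

/-- **The exact form.** On the oval, the difference between the target integrand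
`√2/√f − x/(√2√f)` and the transferred integrand `ψ(x)/(√2√f)` is the derivative of the
Hermite-type primitive `F`: `√2/√f − x/(√2√f) − ψ/(√2√f) = (x² − 8x − 2)/(2(4 − x)√2√f)`.
[folklore] -/
theorem integrand_identity {x : ℝ} (hx4 : x < 4) (hf : 0 < 4 * x ^ 3 - 120 * x + 224) :
    Real.sqrt 2 / Real.sqrt (4 * x ^ 3 - 120 * x + 224) +
      -x / (Real.sqrt 2 * Real.sqrt (4 * x ^ 3 - 120 * x + 224)) -
      (-x / 2 - 9 / (x - 4)) / (Real.sqrt 2 * Real.sqrt (4 * x ^ 3 - 120 * x + 224)) =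
    (x ^ 2 - 8 * x - 2) / (2 * (4 - x) * Real.sqrt 2 * Real.sqrt (4 * x ^ 3 - 120 * x + 224)) := by
  set S := Real.sqrt (4 * x ^ 3 - 120 * x + 224) with hS_def
  have hS0 : 0 < S := Real.sqrt_pos.mpr hf
  have hc : 0 < Real.sqrt 2 := (Real.sqrt_pos.mpr zero_lt_two : 0 < Real.sqrt 2)
  have h4 : x - 4 ≠ 0 := by linarith
  have h4' : 4 - x ≠ 0 := by linarith
  field_simp
  linear_combination (-2 * (x - 4) ^ 2) * (Real.sq_sqrt zero_le_two : Real.sqrt 2 ^ 2 = 2)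

/-- `(ψ/2)·(√2/√f) = ψ/(√2√f)` (the transferred integrand as a bounded multiple of the
integrable `√2/√f`). [folklore] -/
theorem prod_identity {x : ℝ} (hf : 0 < 4 * x ^ 3 - 120 * x + 224) :
    (-x / 2 - 9 / (x - 4)) / 2 * (Real.sqrt 2 / Real.sqrt (4 * x ^ 3 - 120 * x + 224)) =
      (-x / 2 - 9 / (x - 4)) / (Real.sqrt 2 * Real.sqrt (4 * x ^ 3 - 120 * x + 224)) := by
  set S := Real.sqrt (4 * x ^ 3 - 120 * x + 224) with hS_def
  have hS0 : 0 < S := Real.sqrt_pos.mpr hf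
  have hc : 0 < Real.sqrt 2 := (Real.sqrt_pos.mpr zero_lt_two : 0 < Real.sqrt 2)
  rw [div_mul_div_comm, div_eq_div_iff (by positivity) (by positivity)]
  linear_combination ((-x / 2 - 9 / (x - 4)) * S) * (Real.sq_sqrt zero_le_two : Real.sqrt 2 ^ 2 = 2)

end Summit.KontsevichZagierPeriods.HermiteRigidity.CMTwistQuasiPeriodTransfer

end
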